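import Mathlib

/-!
# `InteractionMatrixLaw` is false (crux `FifoMatching.NNDivisionHard`, stmt-ValiantsHypothesis-21181)

val-idea-39 g2's wave-5 target (`Cruxes/NNDivisionHard/RecourseGraph.lean` rev 1.3 @7e0b5a907a4c, §3) asks that
NO matrix `M(a;(b,j)) = (1 − |a ∩ b|)² + G(a,j)` — UDISJ plus a cheap, nonnegative, row-zeroed «recourse» shift
`G` that is constant along `b` — admit a cheap nonnegative factorization, for an ARBITRARY (not necessarily
geometrically realizable) `G`.  This file refutes that law with an explicit polynomial-size counterexample for every
`n`: advice `J := Finset (Fin n)`, `G(a,P) := 2n·|a Δ P|` (rank₊ ≤ 2n, zero exactly on the diagonal) and the explicit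
`(2n² + 2n + 1)`-term nonnegative factorization of `(1 − |a∩b|)² + 2n|aΔP|` (`factor_identity`).  Reading: EXACT advice
is cheap to police with a Hamming penalty, so the «public advice» formulation carries no lower bound at the
pure-matrix level; a proof of COR-VIRTUAL through the recourse matrix must use the realizable structure
`G(a,j) = m_a − ⟨udRow a, q_j⟩` (critic of record val-idea-crit-9 g1, VERDICT #13, 2026-08-28).  Negative lane: no route
statement is asserted and no `Prop`/object is posited (theorems only); the negated law is stated inline in
`interactionMatrixLaw_false`, verbatim from the Cruxes workfile with the line's reducible
`T c n = 2 ^ ((Nat.log 2 n + c) ^ c)` written out.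
-/

namespace Summit.ValiantsHypothesis.Theorems.NNDivisionHardNegative.RecourseMatrix

open Finset

/-! ## The algebraic identity behind the counterexample (a pure ring identity — no 0/1 hypotheses needed) -/

section Identity

variable {ι : Type*} [Fintype ι]

/-- The `(2n²+2n+1)`-term decomposition of `(1 − ⟨x,y⟩)² + λ·Σ (xᵢ(1−pᵢ) + pᵢ(1−xᵢ))`. [folklore] -/
theorem factor_identity (x y p : ι → ℝ) (lam : ℝ) :
    (1 - ∑ i, x i * y i) ^ 2 + lam * ∑ i, (x i * (1 - p i) + p i * (1 - x i)) =
      (1 - ∑ i, p i * y i) ^ 2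
      + ∑ i, x i * ((1 - p i) * (lam - 2 * y i + y i * ∑ k, p k * y k))
      + ∑ i, ∑ k, (x i * x k) * ((1 - p i) * y i * y k)
      + ∑ i, (1 - x i) * (p i * (lam + 2 * y i - y i * (∑ k, p k * y k) - y i * ∑ k, y k))
      + ∑ i, ∑ k, ((1 - x i) * (1 - x k)) * (p i * y i * y k) := by
  set t := ∑ i, x i * y i with ht
  set t' := ∑ i, p i * y i with ht'
  set s := ∑ i, y i with hs
  have h1 : ∑ i, ∑ k, (x i * x k) * ((1 - p i) * y i * y k) = ∑ i, x i * (1 - p i) * y i * t := by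
    refine Finset.sum_congr rfl fun i _ => ?_
    rw [ht, Finset.mul_sum]
    exact Finset.sum_congr rfl fun k _ => by ring
  have hst : ∑ k, (1 - x k) * y k = s - t := by
    rw [hs, ht, ← Finset.sum_sub_distrib]
    exact Finset.sum_congr rfl fun k _ => by ring
  have h2 : ∑ i, ∑ k, ((1 - x i) * (1 - x k)) * (p i * y i * y k) =
      ∑ i, (1 - x i) * p i * y i * (s - t) := by
    refine Finset.sum_congr rfl fun i _ => ?_
    rw [← hst, Finset.mul_sum]
    exact Finset.sum_congr rfl fun k _ => by ring
  have h3 : ∑ i, (x i * (1 - p i) + p i * (1 - x i)) =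
      ∑ i, x i * (1 - p i) + ∑ i, p i * (1 - x i) := Finset.sum_add_distrib
  have hdiff : (1 - t) ^ 2 - (1 - t') ^ 2 = (2 - t - t') * ∑ i, y i * (p i - x i) := by
    have : ∑ i, y i * (p i - x i) = t' - t := by
      rw [ht, ht', ← Finset.sum_sub_distrib]
      exact Finset.sum_congr rfl fun i _ => by ring
    rw [this]; ring
  rw [h1, h2, h3]
  have key : ∑ i, x i * ((1 - p i) * (lam - 2 * y i + y i * t'))
      + ∑ i, x i * (1 - p i) * y i * t
      + ∑ i, (1 - x i) * (p i * (lam + 2 * y i - y i * t' - y i * s))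
      + ∑ i, (1 - x i) * p i * y i * (s - t)
      - lam * (∑ i, x i * (1 - p i) + ∑ i, p i * (1 - x i))
      = (2 - t - t') * ∑ i, y i * (p i - x i) := by
    simp only [Finset.mul_sum, mul_add, ← Finset.sum_add_distrib, ← Finset.sum_sub_distrib]
    exact Finset.sum_congr rfl fun i _ => by ring
  linear_combination hdiff - key

/-- `Σᵢ 𝟙_a(i) 𝟙_b(i) = |a ∩ b|` for 0/1 indicators written as `if`s. [folklore] -/
theorem sum_ite_mul_ite [DecidableEq ι] (a b : Finset ι) :
    ∑ i, (if i ∈ a then (1 : ℝ) else 0) * (if i ∈ b then (1 : ℝ) else 0) = ((a ∩ b).card : ℝ) := by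
  have : ∀ i, (if i ∈ a then (1 : ℝ) else 0) * (if i ∈ b then (1 : ℝ) else 0) = if i ∈ a ∩ b then 1 else 0 :=
    fun i => by by_cases ha : i ∈ a <;> by_cases hb : i ∈ b <;> simp [ha, hb]
  simp only [this]
  rw [Finset.sum_boole, Finset.filter_mem_eq_inter, Finset.univ_inter]

/-- a `[0,1]`-valued sequence sums to at most `card ι`. -/
theorem sum_le_card_of_le_one (f : ι → ℝ) (hf : ∀ i, f i ≤ 1) : ∑ i, f i ≤ Fintype.card ι := by
  calc ∑ i, f i ≤ ∑ _i : ι, (1 : ℝ) := Finset.sum_le_sum fun i _ => hf i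
    _ = Fintype.card ι := by simp

end Identity

/-- the budget arithmetic at `c = 2`, `n = 2^m`: `2·4^m + 2·2^m + 1 ≤ 2^{(m+2)²} + 1`. -/
theorem budget_ineq (m : ℕ) : 2 * (2 ^ m) ^ 2 + 2 * 2 ^ m + 1 ≤ 2 ^ ((m + 2) ^ 2) + 1 := by
  have h1 : (2 : ℕ) ^ m ≤ (2 ^ m) ^ 2 := by
    calc (2:ℕ) ^ m = 2 ^ m * 1 := (mul_one _).symm
      _ ≤ 2 ^ m * 2 ^ m := Nat.mul_le_mul_left _ Nat.one_le_two_pow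
      _ = (2 ^ m) ^ 2 := (sq _).symm
  have h2 : (2 ^ m) ^ 2 = (2 : ℕ) ^ (2 * m) := by rw [← pow_mul, mul_comm]
  have h3 : 4 * (2 : ℕ) ^ (2 * m) = 2 ^ (2 * m + 2) := by rw [pow_add]; norm_num; ring
  have h4 : (2 : ℕ) ^ (2 * m + 2) ≤ 2 ^ ((m + 2) ^ 2) :=
    Nat.pow_le_pow_right (by norm_num) (by nlinarith)
  omega

/-- ★★ **val-idea-39's INTERACTION MATRIX LAW IS FALSE.**  The negated proposition is `RecourseGraph.InteractionMatrixLaw`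
(`Cruxes/NNDivisionHard/RecourseGraph.lean` rev 1.3 §3) VERBATIM, with the line's reducible `T c n` written out as
`2 ^ ((Nat.log 2 n + c) ^ c)` (so `exact interactionMatrixLaw_false` closes `¬ RecourseGraph.InteractionMatrixLaw` by unfolding).
Witness: `c = 2`, `n = 2^{n₀}`, `J = Finset (Fin n)`, `G(a,P) = 2n·|aΔP|` factored through `I₁ = Fin n ⊕ Fin n`, and
`(1 − |a∩b|)² + G(a,P)` factored through `I₂ = Unit ⊕ Fin n ⊕ Fin n² ⊕ Fin n ⊕ Fin n²` (`2n²+2n+1` nonnegative rank-ones, `factor_identity`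
with `x = 𝟙_a`, `y = 𝟙_b`, `p = 𝟙_P`, `λ = 2n`). -/
theorem interactionMatrixLaw_false : ¬
    (∀ c : ℕ, ∃ n₀ : ℕ, ∀ n ≥ n₀, ∀ (J I₁ I₂ : Type) [Fintype J] [Fintype I₁] [Fintype I₂]
      (G : Finset (Fin n) → J → ℝ),
      (∀ a, ∃ j, G a j = 0) →
      (∃ (γ : Finset (Fin n) → I₁ → ℝ) (δ : J → I₁ → ℝ),
          (∀ a l, 0 ≤ γ a l) ∧ (∀ j l, 0 ≤ δ j l) ∧ ∀ a j, G a j = ∑ l, γ a l * δ j l) →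
      (∃ (U : Finset (Fin n) → I₂ → ℝ) (V : Finset (Fin n) × J → I₂ → ℝ),
          (∀ a i, 0 ≤ U a i) ∧ (∀ p i, 0 ≤ V p i) ∧
            ∀ a b j, (1 - ((a ∩ b).card : ℝ)) ^ 2 + G a j = ∑ i, U a i * V (b, j) i) →
      Fintype.card I₁ ≤ 2 ^ ((Nat.log 2 n + c) ^ c) + 1 → 2 ^ ((Nat.log 2 n + c) ^ c) + 1 < Fintype.card I₂) := by
  intro hL
  obtain ⟨n₀, hn₀⟩ := hL 2
  -- take `n := 2 ^ n₀ ≥ n₀`, so that `Nat.log 2 n = n₀`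
  set n : ℕ := 2 ^ n₀ with hn
  have hge : n₀ ≤ n := (Nat.lt_two_pow_self).le
  have hlog : Nat.log 2 n = n₀ := by rw [hn]; exact Nat.log_pow (by norm_num) _
  have hT : 2 ^ ((Nat.log 2 n + 2) ^ 2) = 2 ^ ((n₀ + 2) ^ 2) := by rw [hlog]
  -- the 0/1 indicator `x a = 𝟙_a`, kept opaque behind the equation `hx`
  obtain ⟨x, hx⟩ : ∃ x : Finset (Fin n) → Fin n → ℝ, x = fun a i => if i ∈ a then 1 else 0 := ⟨_, rfl⟩
  have hx0 : ∀ a i, 0 ≤ x a i := fun a i => by rw [hx]; dsimp only; split_ifs <;> norm_num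
  have hx1 : ∀ a i, x a i ≤ 1 := fun a i => by rw [hx]; dsimp only; split_ifs <;> norm_num
  have hx1' : ∀ a i, 0 ≤ 1 - x a i := fun a i => sub_nonneg.mpr (hx1 a i)
  have hxx : ∀ a i, x a i * (1 - x a i) = 0 := fun a i => by rw [hx]; dsimp only; split_ifs <;> norm_num
  have hinter : ∀ a b, ∑ i, x a i * x b i = ((a ∩ b).card : ℝ) := fun a b => by
    rw [hx]; exact sum_ite_mul_ite a b
  have hS0 : ∀ a b, 0 ≤ ∑ i, x a i * x b i := fun a b =>
    Finset.sum_nonneg fun i _ => mul_nonneg (hx0 a i) (hx0 b i)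
  have hS1 : ∀ a b, ∑ i, x a i * x b i ≤ n := fun a b => by
    have := sum_le_card_of_le_one (fun i => x a i * x b i) fun i => by
      have := hx0 a i; have := hx1 a i; have := hx0 b i; have := hx1 b i; nlinarith
    simpa using this
  have hS2 : ∀ b, 0 ≤ ∑ i, x b i := fun b => Finset.sum_nonneg fun i _ => hx0 b i
  have hS3 : ∀ b, ∑ i, x b i ≤ n := fun b => by simpa using sum_le_card_of_le_one (x b) (hx1 b)
  have key := hn₀ n hge (Finset (Fin n)) (Fin n ⊕ Fin n)
    (Unit ⊕ (Fin n ⊕ ((Fin n × Fin n) ⊕ (Fin n ⊕ (Fin n × Fin n)))))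
    -- the recourse shift `G(a,P) = 2n · |a Δ P|`
    (fun a P => (2 * n : ℝ) * ∑ i, (x a i * (1 - x P i) + x P i * (1 - x a i)))
    -- row-zeroed: `G(a,a) = 0`
    (fun a => ⟨a, by
      rw [Finset.sum_eq_zero fun i _ => ?_, mul_zero]
      rw [hxx]; ring⟩)
    -- `G` factors through `Fin n ⊕ Fin n` with nonnegative factors
    ⟨fun a => Sum.elim (fun i => (2 * n : ℝ) * x a i) (fun i => (2 * n : ℝ) * (1 - x a i)),
      fun P => Sum.elim (fun i => 1 - x P i) (fun i => x P i),
      by rintro a (i | i) <;> dsimp only [Sum.elim_inl, Sum.elim_inr]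
         <;> [exact mul_nonneg (by positivity) (hx0 a i); exact mul_nonneg (by positivity) (hx1' a i)],
      by rintro P (i | i) <;> dsimp only [Sum.elim_inl, Sum.elim_inr]
         <;> [exact hx1' P i; exact hx0 P i],
      fun a P => by
        simp only [Fintype.sum_sum_type, Sum.elim_inl, Sum.elim_inr]
        rw [Finset.mul_sum, ← Finset.sum_add_distrib]
        exact Finset.sum_congr rfl fun i _ => by ring⟩
    -- `M` factors through `Unit ⊕ Fin n ⊕ Fin n² ⊕ Fin n ⊕ Fin n²` with nonnegative factors
    ⟨fun a => Sum.elim (fun _ => (1 : ℝ)) (Sum.elim (fun i => x a i) (Sum.elim (fun ik => x a ik.1 * x a ik.2)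
        (Sum.elim (fun i => 1 - x a i) (fun ik => (1 - x a ik.1) * (1 - x a ik.2))))),
      fun bP => Sum.elim (fun _ => (1 - ∑ i, x bP.2 i * x bP.1 i) ^ 2)
        (Sum.elim (fun i => (1 - x bP.2 i) * ((2 * n : ℝ) - 2 * x bP.1 i + x bP.1 i * ∑ k, x bP.2 k * x bP.1 k))
        (Sum.elim (fun ik => (1 - x bP.2 ik.1) * x bP.1 ik.1 * x bP.1 ik.2)
        (Sum.elim (fun i => x bP.2 i * ((2 * n : ℝ) + 2 * x bP.1 i - x bP.1 i * (∑ k, x bP.2 k * x bP.1 k)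
            - x bP.1 i * ∑ k, x bP.1 k))
          (fun ik => x bP.2 ik.1 * x bP.1 ik.1 * x bP.1 ik.2)))),
      by
        rintro a (_ | i | ⟨i, k⟩ | i | ⟨i, k⟩) <;> dsimp only [Sum.elim_inl, Sum.elim_inr]
        · exact zero_le_one
        · exact hx0 a i
        · exact mul_nonneg (hx0 a i) (hx0 a k)
        · exact hx1' a i
        · exact mul_nonneg (hx1' a i) (hx1' a k),
      by
        rintro ⟨b, P⟩ (_ | i | ⟨i, k⟩ | i | ⟨i, k⟩) <;> dsimp only [Sum.elim_inl, Sum.elim_inr]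
        · exact sq_nonneg _
        · refine mul_nonneg (hx1' P i) ?_
          have h1 := hx1 b i
          have h2 := mul_nonneg (hx0 b i) (hS0 P b)
          have hn1 : (1 : ℝ) ≤ n := by exact_mod_cast Nat.succ_le_of_lt (Fin.pos i)
          nlinarith
        · exact mul_nonneg (mul_nonneg (hx1' P i) (hx0 b i)) (hx0 b k)
        · refine mul_nonneg (hx0 P i) ?_
          have h0 := hx0 b i
          have h1 := hx1 b i
          have h3 : x b i * (∑ k, x P k * x b k) ≤ n := by
            have := hS1 P b; have := hS0 P b; nlinarith
          have h4 : x b i * (∑ k, x b k) ≤ n := by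
            have := hS3 b; have := hS2 b; nlinarith
          nlinarith
        · exact mul_nonneg (mul_nonneg (hx0 P i) (hx0 b i)) (hx0 b k),
      fun a b P => by
        rw [← hinter a b]
        dsimp only
        rw [factor_identity (x a) (x b) (x P) (2 * n : ℝ)]
        simp only [Fintype.sum_sum_type, Fintype.sum_prod_type, Finset.univ_unique, Finset.sum_singleton,
          Sum.elim_inl, Sum.elim_inr, one_mul]
        have e1 : ∑ i, x P i * x b i = ∑ i, x b i * x P i := Finset.sum_congr rfl fun i _ => mul_comm _ _
        rw [e1]
        ring⟩
    -- budget of `G`'s factorization: `2n ≤ 2^{(n₀+2)²} + 1`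
    (by
      rw [Fintype.card_sum, Fintype.card_fin, hT]
      have := budget_ineq n₀
      rw [hn]; nlinarith [this])
  have hcard : Fintype.card (Unit ⊕ (Fin n ⊕ ((Fin n × Fin n) ⊕ (Fin n ⊕ (Fin n × Fin n))))) =
      2 * n ^ 2 + 2 * n + 1 := by
    simp only [Fintype.card_sum, Fintype.card_unit, Fintype.card_prod, Fintype.card_fin]; ring
  rw [hcard, hT, hn] at key
  have := budget_ineq n₀
  omega

end Summit.ValiantsHypothesis.Theorems.NNDivisionHardNegative.RecourseMatrix
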